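import Summits.KontsevichZagierPeriods.KontsevichZagierPeriods.Theses.ComplexOrientations
import Summits.KontsevichZagierPeriods.KontsevichZagierPeriods.Theses.AbelContraction
import Summits.KontsevichZagierPeriods.KontsevichZagierPeriods.Theorems.AbelContractionRealArcKernelSplit
import Summits.KontsevichZagierPeriods.KontsevichZagierPeriods.Theorems.AbelContractionRealArcKernelSolidVolumes
import Summits.KontsevichZagierPeriods.KontsevichZagierPeriods.Theorems.ComplexOrientationsOrientationKernelReductionNecessity
import Summits.KontsevichZagierPeriods.KontsevichZagierPeriods.Theorems.ComplexOrientationsOrientationKernelRouteExactness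

/-!
# Crux `OrientationKernel` (stmt-KontsevichZagierPeriods-11367, route ComplexOrientations, rank 0) — line
# `dimtwo_redirect` (crux-strategist cstrat-stmt-KontsevichZagierPeriods-11367-r1, 2026-08-17)

  `OrientationKernel` : every subgroup `R ≥ KZ.relations` of `KZ.FormalRep` that contains (i) the
  type-I unit-sign oval identities, (ii) the integer oval-sector identities of one compact smooth real
  plane curve against a `π`-carrier and (iii) the Cauchy relators contains `ker KZ.eval`.

WHY A SECOND LINE. The registered line `birth` cuts the crux along the 1-period layer:
`OrientationKernel ⟸ ReductionToDimensionOne ∧ PlanarAreas` (composition landed,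
`orientationKernel_of_reductionToDimensionOne_of_planarAreas`, p147979). It is stuck BY CONSTRUCTION:
`PlanarAreas` (stmt-4990) is proved modulo the PUBLISHED theorem of Huber–Wüstholz (cite-only fact
`HuberWustholzCurvePeriods`, landed transfer `SymplecticScissors.PlanarTransport.planarAreas_of_huberWustholzCurvePeriods`),
so its one genuine stub `ReductionToDimensionOne` (stmt-14403) IS the crux IS the summit modulo a published
theorem (landed `orientationKernel_iff_reductionToDimensionOne_of_planarAreas`,
`kontsevichZagierPeriods_iff_reductionToDimensionOne_of_planarAreas`; 14403 carries a `summit_equivalent`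
flag conditional on 4990 and has no skeleton). Lead c16: `blocked-on: stmt-14403 BY THEOREM`.

THIS LINE peels ONE OPEN LAYER MORE along the same input-dimension filtration — oval sector ⊂
`PlanarAreas` ⊂ `KZDimTwo` ⊂ all inputs — exactly as the sibling target `AbelContraction.RealArcKernel`
was redirected (cstrat-12472; lead c3's registered line `Cruxes/RealArcKernel/Lines/dimtwo_redirect.lean`;
split glue landed p148174):

* `stub_kzDimTwo` — Conjecture 1 on the STRATUM of KZ-rational representations of dimensions `≤ 2`
  (= item stmt-4280 VERBATIM, shared with BianchiHumbert / HodgeLevel / DessinsDimensionOne /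
  AbelContraction and, since route rev 2, this route's item `KZDimTwo`). Open in substance (no
  Huber–Wüstholz theorem exists for 2-periods): `ζ(2) ∈ ℚπ²` is landed as a chain (CompiledSubstitutions'
  ZetaEvenBKC, k = 1); Legendre's relation as planar areas, five-term / Clausen identities at algebraic
  points, `L(2,χ)` are open. It contains the whole old layer: `KZDimTwo → PlanarAreas → OvalSector /
  TypeOneIdentities` (landed). IMMEDIATE RESHAPE available to a lead: `stub_kzDimTwo ⟸ stub_solidVolumes`
  (Hilbert III for bounded `ℚ`-semialgebraic solids in `ℝ³` inside the calculus) by the LANDED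
  `AbelContractionRealArcKernelSolidVolumes.kzDimTwo_of_solidVolumes` (p149342) — see `kzDimTwo_of_solidVolumes'`
  below; that is lead c3's v2 of the sibling line, whose stubs would then coincide with this line's.
* `stub_reductionToDimensionTwo` — the kernel conjecture MODULO the stratum (= item stmt-18030 VERBATIM;
  AbelContraction crux 8 and, since rev 2, this route's item `ReductionToDimensionTwo`): every
  `R ≥ KZ.relations` containing `[r] − [r′]` for all equal-valued KZ-rational pairs of dimensions `≤ 2`
  contains `ker KZ.eval`. GPC-strength MODULO THE OPEN STRATUM, stated openly; NECESSARY for the crux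
  (`reductionToDimensionTwo_of_crux` below: landed `reductionToDimensionOne_of_orientationKernel` +
  landed monotonicity `reductionToDimensionTwo_of_reductionToDimensionOne`); its own plan is the ladder
  `Cruxes/RealArcKernel/Lines/reddim2_ladder.lean` (registered on stmt-18030).

Composition (no `sorry` below the stubs): the hypothesis-free `orientationKernel_of_stubs : OrientationKernel`
consuming the two stubs BY NAME (first, so `skeleton check` takes it), and the parametric
`OrientationKernel_of : stub₁-statement → stub₂-statement → OrientationKernel` (pure logic: the stratum
feeds the hypothesis of the reduction at the given admissible `R`; the three relator hypotheses are
carried, not consumed).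
The Theorems-shaped split glue over the route's rev-2 decls (`ComplexOrientationsOrientationKernelSplit.lean`,
`orientationKernel_of_subs : KZDimTwo → ReductionToDimensionTwo → OrientationKernel`) is attached on the
item for a prover to land `--supports stmt-KontsevichZagierPeriods-11367`; then
`route edit --split OrientationKernel --into KZDimTwo ReductionToDimensionTwo --glue-by …orientationKernel_of_subs`.

Disproof used: none exists for this crux (`ledger crux ls`: no `Disproof.lean`, no `Negative/`).
Negatives index: KinematicPlaneConvex only (unrelated). Degenerate data: `x = 0` is in every `R`;
`k = 0`, `β = 0`, empty carriers are relations (route Sketch). BC3 probes (strategist folder `bc/`):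
stubᵢ → crux and stubᵢ → summit FAIL for both stubs under `exact?` / `simpa` / `unfold; simpa` / `aesop` /
`intro; exact?` (20/20); `exact?` finds neither stub (dedup 2/2).

References: M. Kontsevich, D. Zagier, *Periods* (2001), §1.2 Conjecture 1; A. Huber, S. Müller-Stach,
*Periods and Nori Motives* (2017), Conj. 13.2.1; J. Cresson, J. Viu-Sos, JTNB 34 (2022) §1; J. Viu-Sos,
IJNT (2021) Thm 1.1; A. Huber, G. Wüstholz (2022) Thm 13.3.
-/

noncomputable section

open Literature.NumberTheory.Transcendental

namespace Summit.KontsevichZagierPeriods.KontsevichZagierPeriods.Cruxes.OrientationKernel.DimtwoRedirect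

/-! ## Registered stubs -/

/-- **STUB 1 = item stmt-KontsevichZagierPeriods-4280 verbatim** (`KZDimTwo`, Conjecture 1 on the
dimension-two KZ-rational stratum): for `n, m ≤ 2`, KZ-rational representations `r : IntegralRep n`,
`r′ : IntegralRep m` of equal value are KZ-equivalent. Why it might fail: completeness needs a
transcendence theory of 2-periods nobody has (dilog / Clausen values at algebraic points, `ζ(2)·ℚ̄`,
`L(2,χ)`, Legendre as areas); one additive invariant separating an equal-valued KZ-rational pair of
dimension `≤ 2` refutes it and the summit. Closes when stmt-4280 closes; reshapes to `stub_solidVolumes`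
by `kzDimTwo_of_solidVolumes'`. [size XL / open] [cite: KontsevichZagier2001, §1.2 Conjecture 1] -/
theorem stub_kzDimTwo :
    ∀ ⦃n m : ℕ⦄, n ≤ 2 → m ≤ 2 → ∀ (r : KZ.IntegralRep n) (r' : KZ.IntegralRep m),
      r.IsRational → r'.IsRational → r.value = r'.value → KZ.Equivalent r r' := by
  sorry

/-- **STUB 2 = item stmt-KontsevichZagierPeriods-18030 verbatim** (`ReductionToDimensionTwo`, the kernel
conjecture modulo the dimension-two stratum; GPC-strength modulo the OPEN stratum, stated openly;
NECESSARY for the crux — `reductionToDimensionTwo_of_crux`). Why it might fail: iff some value-`0`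
combination of inputs beyond the stratum (`ζ(3)` / MZV, `Γ`-products, elliptic quasi-period products)
is underivable even with every stratum-2 coincidence adjoined. Closes when stmt-18030 closes.
[size open-problem] [cite: KontsevichZagier2001, §1.2 Conjecture 1] -/
theorem stub_reductionToDimensionTwo :
    ∀ R : AddSubgroup KZ.FormalRep, KZ.relations ≤ R →
      (∀ ⦃n m : ℕ⦄, n ≤ 2 → m ≤ 2 → ∀ (r : KZ.IntegralRep n) (r' : KZ.IntegralRep m),
        r.IsRational → r'.IsRational → r.value = r'.value → KZ.of r - KZ.of r' ∈ R) →
      ∀ x : KZ.FormalRep, KZ.eval x = 0 → x ∈ R := by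
  sorry

/-! ## The stubs are the shared items verbatim (kernel-checked identifications) -/

example : (∀ ⦃n m : ℕ⦄, n ≤ 2 → m ≤ 2 → ∀ (r : KZ.IntegralRep n) (r' : KZ.IntegralRep m),
      r.IsRational → r'.IsRational → r.value = r'.value → KZ.Equivalent r r') ↔
    Summit.KontsevichZagierPeriods.KontsevichZagierPeriods.Theses.AbelContraction.KZDimTwo :=
  Iff.rfl

example : (∀ R : AddSubgroup KZ.FormalRep, KZ.relations ≤ R →
      (∀ ⦃n m : ℕ⦄, n ≤ 2 → m ≤ 2 → ∀ (r : KZ.IntegralRep n) (r' : KZ.IntegralRep m),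
        r.IsRational → r'.IsRational → r.value = r'.value → KZ.of r - KZ.of r' ∈ R) →
      ∀ x : KZ.FormalRep, KZ.eval x = 0 → x ∈ R) ↔
    Summit.KontsevichZagierPeriods.KontsevichZagierPeriods.Theses.AbelContraction.ReductionToDimensionTwo :=
  Iff.rfl

/-! ## Composition (no `sorry` below this line) -/

/-- **The skeleton, hypothesis-free** (FIRST crux-concluding theorem, so that `skeleton check` takes it):
the crux `OrientationKernel` BY NAME, the two registered stubs consumed BY NAME — given an admissible
`R ⊇ KZ.relations`, `stub_kzDimTwo` puts every equal-valued KZ-rational pair of dimensions `≤ 2` inside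
`KZ.relations ≤ R`, and `stub_reductionToDimensionTwo` puts `ker KZ.eval` inside `R`; the relator
hypotheses (i)–(iii) on `R` are carried, not consumed. `#print axioms` = whitelist ∪ {sorryAx via the
two stubs only}. [cite: KontsevichZagier2001, §1.2 Conjecture 1] -/
theorem orientationKernel_of_stubs :
    Summit.KontsevichZagierPeriods.KontsevichZagierPeriods.Theses.ComplexOrientations.OrientationKernel := by
  -- the two stub statements, by name
  have h₂ := stub_kzDimTwo
  have hRed := stub_reductionToDimensionTwo
  -- the composition proper
  intro R hR _hI _hII _hIII x hx
  exact hRed R hR (fun _ _ hn hm r r' hr hr' hv => hR (h₂ hn hm r r' hr hr' hv)) x hx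

/-- **`OrientationKernel_of`**, parametric form over the route's rev-2 items BY NAME (= the split glue
`KZDimTwo → ReductionToDimensionTwo → OrientationKernel`; Theorems-shaped file
`ComplexOrientationsOrientationKernelSplit.lean` attached on the item for a prover to land; the two items
are the stub statements verbatim, `Iff.rfl`). [cite: KontsevichZagier2001, §1.2 Conjecture 1] -/
theorem OrientationKernel_of :
    Summit.KontsevichZagierPeriods.KontsevichZagierPeriods.Theses.ComplexOrientations.KZDimTwo →
    Summit.KontsevichZagierPeriods.KontsevichZagierPeriods.Theses.ComplexOrientations.ReductionToDimensionTwo →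
    Summit.KontsevichZagierPeriods.KontsevichZagierPeriods.Theses.ComplexOrientations.OrientationKernel :=
  fun h₂ hRed R hR _ _ _ x hx => hRed R hR (fun _ _ hn hm r r' hr hr' hv => hR (h₂ hn hm r r' hr hr' hv)) x hx

-- The stub statements ARE the route's rev-2 items (kernel-checked identifications).
example : (∀ ⦃n m : ℕ⦄, n ≤ 2 → m ≤ 2 → ∀ (r : KZ.IntegralRep n) (r' : KZ.IntegralRep m),
      r.IsRational → r'.IsRational → r.value = r'.value → KZ.Equivalent r r') ↔
    Summit.KontsevichZagierPeriods.KontsevichZagierPeriods.Theses.ComplexOrientations.KZDimTwo :=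
  Iff.rfl

example : (∀ R : AddSubgroup KZ.FormalRep, KZ.relations ≤ R →
      (∀ ⦃n m : ℕ⦄, n ≤ 2 → m ≤ 2 → ∀ (r : KZ.IntegralRep n) (r' : KZ.IntegralRep m),
        r.IsRational → r'.IsRational → r.value = r'.value → KZ.of r - KZ.of r' ∈ R) →
      ∀ x : KZ.FormalRep, KZ.eval x = 0 → x ∈ R) ↔
    Summit.KontsevichZagierPeriods.KontsevichZagierPeriods.Theses.ComplexOrientations.ReductionToDimensionTwo :=
  Iff.rfl

/-! ## Strength of the stubs (all from landed theorems; sorry-free) -/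

/-- **Stub 2 is NECESSARY for the crux** (`OrientationKernel → ReductionToDimensionTwo`): the landed
`reductionToDimensionOne_of_orientationKernel` (p147979) followed by the landed monotonicity of the
input-dimension filtration `reductionToDimensionTwo_of_reductionToDimensionOne` (p148174).
[cite: KontsevichZagier2001, §1.2 Conjecture 1] -/
theorem reductionToDimensionTwo_of_crux
    (h : Summit.KontsevichZagierPeriods.KontsevichZagierPeriods.Theses.ComplexOrientations.OrientationKernel) :
    ∀ R : AddSubgroup KZ.FormalRep, KZ.relations ≤ R →
      (∀ ⦃n m : ℕ⦄, n ≤ 2 → m ≤ 2 → ∀ (r : KZ.IntegralRep n) (r' : KZ.IntegralRep m),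
        r.IsRational → r'.IsRational → r.value = r'.value → KZ.of r - KZ.of r' ∈ R) →
      ∀ x : KZ.FormalRep, KZ.eval x = 0 → x ∈ R :=
  Summit.KontsevichZagierPeriods.AbelContraction.RealArcKernelSplit.reductionToDimensionTwo_of_reductionToDimensionOne
    (Summit.KontsevichZagierPeriods.ComplexOrientations.OrientationKernel.reductionToDimensionOne_of_orientationKernel h)

/-- **The reshape of stub 1** (lead c3's v2 of the sibling line): Hilbert's third problem for bounded
`ℚ`-semialgebraic solids in `ℝ³` inside the calculus implies `stub_kzDimTwo` (landed
`kzDimTwo_of_solidVolumes`, p149342: `[r] ≡ [s] − [s′]` with bounded solids, cross-merge, volumes by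
soundness). [cite: KontsevichZagier2001, §1.2 Conjecture 1] -/
theorem kzDimTwo_of_solidVolumes'
    (h3 : ∀ (u v : KZ.IntegralRep 3), (Bornology.IsBounded u.domain ∧ ∀ z ∈ u.domain, u.integrand z = 1) →
      (Bornology.IsBounded v.domain ∧ ∀ z ∈ v.domain, v.integrand z = 1) → u.value = v.value →
      KZ.Equivalent u v) :
    ∀ ⦃n m : ℕ⦄, n ≤ 2 → m ≤ 2 → ∀ (r : KZ.IntegralRep n) (r' : KZ.IntegralRep m),
      r.IsRational → r'.IsRational → r.value = r'.value → KZ.Equivalent r r' :=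
  Summit.KontsevichZagierPeriods.AbelContraction.RealArcKernelSolidVolumes.kzDimTwo_of_solidVolumes h3

/-- Stub 1 contains the whole old layer of line `birth`: `stub_kzDimTwo-statement → PlanarAreas`
(landed `planarAreas_of_kzDimTwo`) — hence also `OvalSector` and `TypeOneIdentities`
(landed `ovalSector_of_planarAreas`, `typeOneIdentities_of_planarAreas`). [cite: KontsevichZagier2001, §1.2] -/
theorem ovalSector_of_stub₁
    (h₂ : ∀ ⦃n m : ℕ⦄, n ≤ 2 → m ≤ 2 → ∀ (r : KZ.IntegralRep n) (r' : KZ.IntegralRep m),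
      r.IsRational → r'.IsRational → r.value = r'.value → KZ.Equivalent r r') :
    Summit.KontsevichZagierPeriods.KontsevichZagierPeriods.Theses.ComplexOrientations.OvalSector :=
  Summit.KontsevichZagierPeriods.ComplexOrientations.OrientationKernel.ovalSector_of_planarAreas
    (Summit.KontsevichZagierPeriods.AbelContraction.RealArcKernelSplit.planarAreas_of_kzDimTwo h₂)

/-- Both stubs are consequences of the summit (so a refutation of either refutes the summit).
[cite: KontsevichZagier2001, §1.2 Conjecture 1] -/
theorem stubs_of_kontsevichZagierPeriods (h : KontsevichZagierPeriods) :
    (∀ ⦃n m : ℕ⦄, n ≤ 2 → m ≤ 2 → ∀ (r : KZ.IntegralRep n) (r' : KZ.IntegralRep m),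
      r.IsRational → r'.IsRational → r.value = r'.value → KZ.Equivalent r r') ∧
    (∀ R : AddSubgroup KZ.FormalRep, KZ.relations ≤ R →
      (∀ ⦃n m : ℕ⦄, n ≤ 2 → m ≤ 2 → ∀ (r : KZ.IntegralRep n) (r' : KZ.IntegralRep m),
        r.IsRational → r'.IsRational → r.value = r'.value → KZ.of r - KZ.of r' ∈ R) →
      ∀ x : KZ.FormalRep, KZ.eval x = 0 → x ∈ R) :=
  ⟨fun _ _ _ _ r r' hr hr' hv => h r r' hr hr' hv,
    Summit.KontsevichZagierPeriods.AbelContraction.RealArcKernelSplit.reductionToDimensionTwo_of_kontsevichZagierPeriods h⟩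

/-- Jointly the stubs decide the summit THROUGH this route's deciding theorem `closes`.
[cite: KontsevichZagier2001, §1.2 Conjecture 1] -/
theorem kontsevichZagierPeriods_of_stub_statements
    (h₂ : ∀ ⦃n m : ℕ⦄, n ≤ 2 → m ≤ 2 → ∀ (r : KZ.IntegralRep n) (r' : KZ.IntegralRep m),
      r.IsRational → r'.IsRational → r.value = r'.value → KZ.Equivalent r r')
    (hRed : ∀ R : AddSubgroup KZ.FormalRep, KZ.relations ≤ R →
      (∀ ⦃n m : ℕ⦄, n ≤ 2 → m ≤ 2 → ∀ (r : KZ.IntegralRep n) (r' : KZ.IntegralRep m),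
        r.IsRational → r'.IsRational → r.value = r'.value → KZ.of r - KZ.of r' ∈ R) →
      ∀ x : KZ.FormalRep, KZ.eval x = 0 → x ∈ R) : KontsevichZagierPeriods :=
  Summit.KontsevichZagierPeriods.KontsevichZagierPeriods.Theses.ComplexOrientations.closes
    (Summit.KontsevichZagierPeriods.ComplexOrientations.OrientationKernel.typeOneIdentities_of_planarAreas
      (Summit.KontsevichZagierPeriods.AbelContraction.RealArcKernelSplit.planarAreas_of_kzDimTwo h₂))
    (ovalSector_of_stub₁ h₂) Summit.KontsevichZagierPeriods.ComplexOrientations.cauchyMove_proof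
    (OrientationKernel_of h₂ hRed)

end Summit.KontsevichZagierPeriods.KontsevichZagierPeriods.Cruxes.OrientationKernel.DimtwoRedirect

end
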